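import Summits.NavierStokesRegularity.NavierStokesRegularity.Theorems.SwirlGaugedTower
import Literature.Analysis.FluidPDE.SereginZajaczkowski2007
import Literature.Analysis.FluidPDE.AxisymHouLiVariables
import Literature.Analysis.FluidPDE.NSLerayHopfSereginMild
import HarnessLib

/-!
# ROUND-18 (nsreg-p2, gen 20) — `SwirlFreeBudget`: the swirl-free end of the tower is a THEOREM
# in the energy–pressure gauge (answer to ROUND-17 test T-17.5)

ROUND-16/17 split the quantitative axisymmetric problem near the axis into a HÖLDER law for the
swirl with an Arrhenius rate (`MeridionalGaugedHolderLaw`, the exponential lives there) and a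
POLYNOMIAL budget for the trapping gauge (`MeridionalSwirlLaw κ`: below the polynomial scale
`(K(1+M)^K)⁻¹` the meridional Péclet gauge is `≤ κ(osc Γ)`).  ROUND-17's honest gap (ii) and its
test T-17.5 asked for the swirl-free rung `N₀ = MeridionalSwirlLaw κ` at `a = b`: prove it from the
swirl-free theory, or record which extra gauge the threshold needs.

**Answer (this file).**  (1) `N₀` depends on the solution only through ONE number, an `L^∞` bound
on `u` near the axis: every gauge `Pe` that is VELOCITY-DOMINATED (`|u| ≤ L` a.e. on `Q(z,ρ)` ⇒
`Pe ρ z u ≤ c₁ L ρ`; R17's `meridionalPeclet` is, with `c₁ = 4π` — S-18.1, PROVED below) obeys the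
budget law as soon as the swirl-free class obeys a POLYNOMIAL ε-FREE LOCAL BOUND
`‖u‖_{L^∞(Q(z₀,1/64))} ≤ K(1+M)^K` (`SwirlFreePolynomialBound`, statement P₀) — PROVED here:
`swirlFreeBudget_of_polynomialBound`, threshold `ρ₁ = min(1/64, κ₀/((c₁+1)K(1+M)^K)) ≥
(K'(1+M)^{K'})⁻¹`, `K' = max(K, 64, (c₁+1)K/κ₀)` (`threshold_lower_bound`).
(2) P₀ is reduced to ONE a-priori estimate on smooth solutions, the η-MOSER LEMMA
(`EtaMoserBound`, crux K-18.1): for a smooth axisymmetric swirl-free suitable solution in an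
axis-centred cylinder `Q(z₀,R)`,
`sup_{Q(z₀,R/2)} |ω_θ/r| ≤ K (1 + A(z₀,R))^K E(z₀,R)^{1/2} R⁻³`
(`A` = CKN scaled energy, `E` = scaled enstrophy; dimensionally exact: `η = ω_θ/r` has parabolic
dimension `-3`).  Engine (memo §1): `η` solves `∂ₜη + b·∇η = Δη + (2/r)∂ᵣη` with NO source when
`u_θ ≡ 0`; Moser's iteration in the 3-D formulation with the Chen–Tsai–Zhang drift absorption
(arXiv:2201.01766 Lemma 2.1: the drift costs only `(1+A)²/(δ⁴R²)` per step), the axis term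
`-(2π/m)∫|η|^{2m}φ²|_{r=0} ≤ 0` DROPPED (good sign — the opposite of the swirl case), and the
iteration STARTED at `p = 1/2`, where Hölder against `r^{-2/3} ∈ L¹_loc` gives
`‖η‖_{L^{1/2}(Q_R)} ≤ c E^{1/2} R⁷` from the enstrophy alone; exponent `K = 10 = (5/2)·(2/p)`.
(3) THE GAUGE (T-17.5's question "which gauge the threshold needs"): the engine's start norm is
the ENSTROPHY `E(z₀,R)`, which the all-points energy gauge `A ≤ M` of R16/R17 does NOT control
universally (CKN's iteration `E(ρ) ≤ poly(M) + 2^{-k}(E+D)(1/4)` keeps a solution-dependent data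
term), but which the CRITICAL, scale-invariant energy–pressure gauge `A, C, D ≤ M` does
(CTZ22 Lemma 3.1: `A(ρ)+E(ρ) ≤ N(1 + C(2ρ) + D(2ρ))`).  So R18 states `N₀` and P₀ in the FULL CKN
GAUGE (`FullGauge`), records the A-only versions (`…A`) as the open strengthening, and proves the
monotonicity between them.  No dimensionful gauge (`‖η‖_∞`, `‖ω₀‖_{L¹}`) enters: the threshold
stays polynomial in a critical quantity, as LADDER-NS N0 requires.

What is NOT claimed: the with-swirl budget `MeridionalSwirlLaw κ` for `b > a` (hard core
`stmt-2002`: the η-equation then has the source `∂_z(Γ²)/r⁴`, Moser-admissible only for a swirl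
Hölder exponent `γ > 8/5` — out of reach; this is exactly where the Ω/J coupling of
Chen–Fang–Zhang / Lei–Zhang is needed); the A-only `N₀` (open, §4); any statement about the Hölder
law `M⁺`.  P₀ for suitable weak solutions = `EtaMoserBound` + the tree's clean-first-singular-point
device (`…Seregin2020TypeIINoSwirlReduction`) + Helmholtz (`exists_const_norm_le_of_curl_le_local`)
+ CTZ22 Lemma 3.1 — crux K-18.2 (assembly, measure theory), not done here.

Contents: §1 frames; §2 the η-Moser lemma (statement); §3 P₀ and the budget law over a
velocity-dominated gauge, the PROVED join and threshold algebra; §4 the A-only versions and the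
monotonicity lemmas; §5 R17's meridional Péclet gauge (verbatim interface copy of R17 §3 — the
tree's `Theorems/MeridionalBarrier.lean` of 2026-08-27 carries R17 §1–2 only), the PROVED domination
`MeridionalPecletDominated` (`c₁ = 4π`) and the instantiated join `N₀^{full}`; §6 R19-PREP: the typed
swirl-THRESHOLD rungs (`SwirlThresholdBudget`, Arrhenius threshold; `SwirlThresholdPolynomialBound`)
and the proved ladder polynomial-threshold ⇒ Arrhenius-threshold ⇒ P₀ ⇒ N₀^{full}.
No sorry, no new axioms.

This file: §§1–4.  §5 (R17's meridional Péclet gauge, S-18.1 and the instantiated law) is the sibling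
`…Theorems.SwirlFreeBudgetMeridional`, re-pointed to the tree module `…Theorems.MeridionalBarrier`
(split for the 400-line rule by the landing seat nsreg-p4; planner nsreg-p2's companion
`R18-SwirlFreeBudget.lean`, sha16 3722b743a4316dc3, is otherwise verbatim; its `parabolicCylinder_subset_of_le` is the
tree's `Literature.Analysis.FluidPDE.parabolicCylinder_subset_of_le`, used instead — gate dedup rule).
Memo: `run/shared/lean/pub/ns-regularity-ideate/ns-regularity-ideate-p2/ROUND-18.md`.
-/

namespace Summit.NavierStokesRegularity.NavierStokesRegularity.Theorems.SwirlFreeBudget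

open MeasureTheory Set Filter Topology Metric
open scoped ENNReal NNReal
open Literature.Analysis Literature.Analysis.FluidPDE
open Literature.Analysis.FluidPDE.SereginZajaczkowski2007

noncomputable section

/-! ## 1. Frames: the energy gauge (R16/R17) and the full CKN energy–pressure gauge (R18) -/

/-- R16/R17's frame: the CKN scaled energy `A(z,R) = sup_t R⁻¹ ∫_{B(x,R)} |u|²` is `≤ M` at all
points of `Q(1/2)` and all scales `R ≤ 1/4`. -/
def EnergyGauge (M : ℝ) (u : ℝ → EuclideanSpace ℝ (Fin 3) → EuclideanSpace ℝ (Fin 3)) : Prop :=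
  ∀ z ∈ parabolicCylinder (1 / 2) (0 : ℝ × EuclideanSpace ℝ (Fin 3)), ∀ R : ℝ, 0 < R → R ≤ 1 / 4 →
    cknA R z u ≤ ENNReal.ofReal M

/-- **R18's frame, the FULL CKN GAUGE**: the three critical Caffarelli–Kohn–Nirenberg quantities
`A(z,R)` (scaled energy), `C(z,R) = R⁻² ∫∫_{Q(z,R)} |u|³` and `D(z,R) = R⁻² ∫∫_{Q(z,R)} |p|^{3/2}`
are `≤ M` at all points of `Q(1/2)` and all scales `R ≤ 1/4`.  All three are scale-invariant and
junk-free on the suitable class (`cknA`, `cknC` take `u`, `cknD` takes `p`); by the local energy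
inequality they control the scaled enstrophy: `A(ρ) + E(ρ) ≤ N (1 + C(2ρ) + D(2ρ))`
(Chen–Tsai–Zhang arXiv:2201.01766, Lemma 3.1). -/
def FullGauge (M : ℝ) (u : ℝ → EuclideanSpace ℝ (Fin 3) → EuclideanSpace ℝ (Fin 3))
    (p : ℝ → EuclideanSpace ℝ (Fin 3) → ℝ) : Prop :=
  ∀ z ∈ parabolicCylinder (1 / 2) (0 : ℝ × EuclideanSpace ℝ (Fin 3)), ∀ R : ℝ, 0 < R → R ≤ 1 / 4 →
    cknA R z u ≤ ENNReal.ofReal M ∧ cknC R z u ≤ ENNReal.ofReal M ∧ cknD R z p ≤ ENNReal.ofReal M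

/-- The full gauge contains the energy gauge. -/
theorem FullGauge.energyGauge {M : ℝ} {u : ℝ → EuclideanSpace ℝ (Fin 3) → EuclideanSpace ℝ (Fin 3)}
    {p : ℝ → EuclideanSpace ℝ (Fin 3) → ℝ} (h : FullGauge M u p) : EnergyGauge M u :=
  fun z hz R hR hR4 => (h z hz R hR hR4).1

/-! ## 2. The η-Moser lemma (crux K-18.1): an a-priori estimate on SMOOTH swirl-free solutions -/

/-- **K-18.1 `EtaMoserBound` — the local maximum estimate for `η = ω_θ/r` with polynomial gauge
dependence.**  There is a universal `K > 0` such that for every smooth axisymmetric suitable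
solution `(V, P)` of Navier–Stokes (`ν = 1`) in an axis-centred parabolic cylinder `Q(z₀, R)`
(`cylRadius z₀.2 = 0`; the Seregin–Zajączkowski smooth class on the OPEN cylinder, i.e. smooth
below the top time) WITHOUT SWIRL there, with scaled energy `A(z₀,R) ≤ A` and scaled enstrophy
`E(z₀,R) = R⁻¹ ∫∫_{Q(z₀,R)} |∇V|² ≤ E`,
`|ω_θ/r| ≤ K (1 + A)^K √E / R³` on `Q(z₀, R/2)` (`angVortQuot (V t) = ω_θ/r`, the smooth radial
quotient).  Informal proof (memo §1): Moser iteration for `∂ₜη + b·∇η = Δη + (2/r)∂ᵣη`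
(test functions `|η|^{2m-2}η φ²`, measure `r dr dθ dz`; axis boundary term `≤ 0` dropped; cut-off
term `(2π/m)∫|η|^{2m}|∂ᵣφ²| ≤ N(mδ²R²)⁻¹∫|η|^{2m}` for radial-in-`|x-x₀|` cut-offs about an axis
point; drift absorbed with `A` only as in CTZ22 Lemma 2.1) gives
`sup_{Q(σR)} |η| ≤ N ((1+A)/((1-σ)… R))^{5/2} ‖η‖_{L²}`; the standard `p < 2` reduction started
at `p = 1/2` with `∫_{Q_R} |η|^{1/2} ≤ (∫∫ω_θ²)^{1/4} (∫_{Q_R} r^{-2/3})^{3/4} ≤ c E^{1/4} R^{7/2}`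
gives the claim with `K = 10`.  Why it might fail: only through an error in the boundary/cut-off
bookkeeping at `r = 0` (the sign of the axis term is the crux of the matter; for `Γ = r u_θ` the
same term has the opposite sign and is killed by `Γ|_{r=0} = 0` instead).
Sources: CTZ22 arXiv:2201.01766 Lemma 2.1; KNSS arXiv:0709.3599 §5; Seregin–Šverák
arXiv:0804.1803 App. II; Feng–Šverák 2015 Lemma 3.8 / Gallay–Šverák arXiv:1510.01036 Lemma 5.2
(the GLOBAL Nash version `‖η(t)‖_{L^p} ≤ C t^{-3/2(1-1/p)} ‖η₀‖_{L¹}`). -/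
@[conjecture] def EtaMoserBound : Prop :=
  ∃ K : ℝ, 0 < K ∧
    ∀ (V : ℝ → EuclideanSpace ℝ (Fin 3) → EuclideanSpace ℝ (Fin 3))
      (P : ℝ → EuclideanSpace ℝ (Fin 3) → ℝ) (z₀ : ℝ × EuclideanSpace ℝ (Fin 3)) (R : ℝ),
      0 < R → cylRadius z₀.2 = 0 →
      IsSmoothAxisymmetricSolutionOn (parabolicCylinderOpens R z₀) V P →
      (∀ z ∈ parabolicCylinder R z₀, swirl (V z.1) z.2 = 0) →
      ∀ A E : ℝ, 0 ≤ A → 0 ≤ E →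
      cknA R z₀ V ≤ ENNReal.ofReal A →
      cknE R z₀ (fun t x => fderiv ℝ (V t) x) ≤ ENNReal.ofReal E →
      ∀ z ∈ parabolicCylinder (R / 2) z₀,
        |angVortQuot (V z.1) z.2| ≤ K * (1 + A) ^ K * Real.sqrt E / R ^ 3

/-! ## 3. P₀, the budget law over a velocity-dominated gauge, and the PROVED join -/

/-- **P₀ `SwirlFreePolynomialBound` — polynomial ε-free local boundedness of the swirl-free class
in the full CKN gauge.**  Universal `K > 0`: every axisymmetric suitable weak solution in `Q₁` with
`A, C, D ≤ M` at all points of `Q(1/2)` and scales `≤ 1/4`, swirl-free a.e. on `Q(z₀, 1/4)` about an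
axis point `z₀ ∈ Q(1/8)`, satisfies `|u| ≤ K(1+M)^K` a.e. on `Q(z₀, 1/64)`.  (Qualitative
boundedness is print — Seregin–Šverák 2009 Thm 1.3, Seregin 2020; and tree — the
`…Seregin2020TypeIINoSwirl*` family via the η MAXIMUM PRINCIPLE.  The content is the POLYNOMIAL,
ε-free dependence on the critical gauges, = crux K-18.2: `EtaMoserBound` + the tree's
clean-first-singular-point reduction + CTZ22 Lemma 3.1 + the local Helmholtz bound
`exists_const_norm_le_of_curl_le_local`.) -/
@[conjecture] def SwirlFreePolynomialBound : Prop :=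
  ∃ K : ℝ, 0 < K ∧
    ∀ (u : ℝ → EuclideanSpace ℝ (Fin 3) → EuclideanSpace ℝ (Fin 3))
      (p : ℝ → EuclideanSpace ℝ (Fin 3) → ℝ),
      IsSuitableWeakSolutionInBall 1 0 u p →
      (∀ t ∈ Ioo (-1 : ℝ) 0, IsAxisymmetric (u t)) →
      (∀ t ∈ Ioo (-1 : ℝ) 0, IsAxisymmetricScalar (p t)) →
      ∀ M : ℝ, 0 ≤ M → FullGauge M u p →
      ∀ z₀ ∈ parabolicCylinder (1 / 8) (0 : ℝ × EuclideanSpace ℝ (Fin 3)), cylRadius z₀.2 = 0 →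
      (∀ᵐ z ∂(volume.restrict (parabolicCylinder (1 / 4) z₀)), swirl (u z.1) z.2 = 0) →
      ∀ᵐ z ∂(volume.restrict (parabolicCylinder (1 / 64) z₀)), ‖u z.1 z.2‖ ≤ K * (1 + M) ^ K

/-- A scale-invariant gauge functional `Pe ρ z u ∈ [0, ∞]` is **velocity-dominated** with constant
`c₁` if an a.e. bound `|u| ≤ L` on `Q(z, ρ)` forces `Pe ρ z u ≤ c₁ L ρ`.  (R17's `meridionalPeclet`:
`c₁ = 4π` PROVED in §5, S-18.1 — the Péclet density is `≤ |u|/r` and `∫_{B_ρ} dy/r ≤ 4πρ²`; the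
sharp shell constant would be `3π²/4`.) -/
def VelocityDominated (c₁ : ℝ)
    (Pe : ℝ → ℝ × EuclideanSpace ℝ (Fin 3) →
      (ℝ → EuclideanSpace ℝ (Fin 3) → EuclideanSpace ℝ (Fin 3)) → ℝ≥0∞) : Prop :=
  ∀ (ρ : ℝ) (z : ℝ × EuclideanSpace ℝ (Fin 3))
    (u : ℝ → EuclideanSpace ℝ (Fin 3) → EuclideanSpace ℝ (Fin 3)) (L : ℝ), 0 < ρ → 0 ≤ L →
    (∀ᵐ q ∂(volume.restrict (parabolicCylinder ρ z)), ‖u q.1 q.2‖ ≤ L) →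
    Pe ρ z u ≤ ENNReal.ofReal (c₁ * L * ρ)

/-- **N₀^{full} `SwirlFreeBudget Pe κ₀` — the swirl-free budget law for the gauge `Pe` in the full
CKN gauge**: universal `K > 0`; for every solution of the P₀ class and every axis point
`z₀ ∈ Q(1/8)` there is a threshold `ρ₁ ∈ [(K(1+M)^K)⁻¹, 1/4]` below which `Pe ρ' z₀ u ≤ κ₀`.
For `Pe = meridionalPeclet` this is ROUND-17's `MeridionalSwirlLaw κ` at `a = b` (`κ₀ = κ 0`),
with the frame strengthened from the energy gauge to the full gauge (§4 has the A-only version). -/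
def SwirlFreeBudget
    (Pe : ℝ → ℝ × EuclideanSpace ℝ (Fin 3) →
      (ℝ → EuclideanSpace ℝ (Fin 3) → EuclideanSpace ℝ (Fin 3)) → ℝ≥0∞) (κ₀ : ℝ) : Prop :=
  ∃ K : ℝ, 0 < K ∧
    ∀ (u : ℝ → EuclideanSpace ℝ (Fin 3) → EuclideanSpace ℝ (Fin 3))
      (p : ℝ → EuclideanSpace ℝ (Fin 3) → ℝ),
      IsSuitableWeakSolutionInBall 1 0 u p →
      (∀ t ∈ Ioo (-1 : ℝ) 0, IsAxisymmetric (u t)) →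
      (∀ t ∈ Ioo (-1 : ℝ) 0, IsAxisymmetricScalar (p t)) →
      ∀ M : ℝ, 0 ≤ M → FullGauge M u p →
      ∀ z₀ ∈ parabolicCylinder (1 / 8) (0 : ℝ × EuclideanSpace ℝ (Fin 3)), cylRadius z₀.2 = 0 →
      (∀ᵐ z ∂(volume.restrict (parabolicCylinder (1 / 4) z₀)), swirl (u z.1) z.2 = 0) →
      ∃ ρ₁ : ℝ, (K * (1 + M) ^ K)⁻¹ ≤ ρ₁ ∧ ρ₁ ≤ 1 / 4 ∧
        ∀ ρ' : ℝ, 0 < ρ' → ρ' ≤ ρ₁ → Pe ρ' z₀ u ≤ ENNReal.ofReal κ₀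

/-- **Threshold algebra.**  With `K' = max(K, 64, (c+1)K/κ₀)` the threshold
`ρ₁ = min(1/64, κ₀/((c+1)·K(1+M)^K))` is at least `(K'(1+M)^{K'})⁻¹` — polynomial in `1+M`. -/
theorem threshold_lower_bound {K c κ₀ M : ℝ} (hK : 0 < K) (hc : 0 ≤ c) (hκ₀ : 0 < κ₀)
    (hM : 0 ≤ M) :
    (max (max K 64) ((c + 1) * K / κ₀) * (1 + M) ^ max (max K 64) ((c + 1) * K / κ₀))⁻¹
      ≤ min (1 / 64) (κ₀ / ((c + 1) * (K * (1 + M) ^ K))) := by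
  set K' := max (max K 64) ((c + 1) * K / κ₀) with hK'_def
  have hK'32 : (64 : ℝ) ≤ K' := le_max_of_le_left (le_max_right _ _)
  have hK'K : K ≤ K' := le_max_of_le_left (le_max_left _ _)
  have hK'c : (c + 1) * K / κ₀ ≤ K' := le_max_right _ _
  have h1M : (1 : ℝ) ≤ 1 + M := by linarith
  have hpowK' : (1 : ℝ) ≤ (1 + M) ^ K' := Real.one_le_rpow h1M (by linarith)
  have hpow_mono : (1 + M) ^ K ≤ (1 + M) ^ K' := Real.rpow_le_rpow_of_exponent_le h1M hK'K
  have hpowK_pos : 0 < (1 + M) ^ K := Real.rpow_pos_of_pos (by linarith) K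
  refine le_min ?_ ?_
  · rw [one_div]
    apply inv_anti₀ (by norm_num)
    calc (64 : ℝ) = 64 * 1 := by ring
      _ ≤ K' * (1 + M) ^ K' := mul_le_mul hK'32 hpowK' zero_le_one (by linarith)
  · have hX : 0 < (c + 1) * (K * (1 + M) ^ K) := by positivity
    rw [show κ₀ / ((c + 1) * (K * (1 + M) ^ K)) = (((c + 1) * (K * (1 + M) ^ K)) / κ₀)⁻¹ by
      rw [inv_div]]
    apply inv_anti₀ (by positivity)
    calc (c + 1) * (K * (1 + M) ^ K) / κ₀ = ((c + 1) * K / κ₀) * (1 + M) ^ K := by ring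
      _ ≤ K' * (1 + M) ^ K' := mul_le_mul hK'c hpow_mono hpowK_pos.le (by linarith)

/-- **THE JOIN (proved): P₀ ⇒ N₀^{full} for every velocity-dominated gauge and every `κ₀ > 0`.**
Threshold `ρ₁ = min(1/64, κ₀/((c₁+1)K(1+M)^K))`; below it `Pe ρ' ≤ c₁ K(1+M)^K ρ' ≤ κ₀`. -/
theorem swirlFreeBudget_of_polynomialBound {c₁ : ℝ}
    {Pe : ℝ → ℝ × EuclideanSpace ℝ (Fin 3) →
      (ℝ → EuclideanSpace ℝ (Fin 3) → EuclideanSpace ℝ (Fin 3)) → ℝ≥0∞}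
    (hc₁ : 0 ≤ c₁) (hPe : VelocityDominated c₁ Pe) (hP : SwirlFreePolynomialBound) {κ₀ : ℝ}
    (hκ₀ : 0 < κ₀) : SwirlFreeBudget Pe κ₀ := by
  obtain ⟨K, hK, hb⟩ := hP
  refine ⟨max (max K 64) ((c₁ + 1) * K / κ₀),
    lt_of_lt_of_le (by norm_num) (le_max_of_le_left (le_max_right _ _)), ?_⟩
  intro u p hsol hax hpax M hM hG z₀ hz₀ haxis hsw
  have hbound := hb u p hsol hax hpax M hM hG z₀ hz₀ haxis hsw
  set L := K * (1 + M) ^ K with hL_def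
  have hL : 0 < L := by positivity
  refine ⟨min (1 / 64) (κ₀ / ((c₁ + 1) * L)), threshold_lower_bound hK hc₁ hκ₀ hM,
    le_trans (min_le_left _ _) (by norm_num), ?_⟩
  intro ρ' hρ' hρ'1
  have hsub : parabolicCylinder ρ' z₀ ⊆ parabolicCylinder (1 / 64) z₀ :=
    parabolicCylinder_subset_of_le hρ'.le (hρ'1.trans (min_le_left _ _)) z₀
  have hae : ∀ᵐ q ∂(volume.restrict (parabolicCylinder ρ' z₀)), ‖u q.1 q.2‖ ≤ L :=
    ae_restrict_of_ae_restrict_of_subset hsub hbound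
  refine (hPe ρ' z₀ u L hρ' hL.le hae).trans (ENNReal.ofReal_le_ofReal ?_)
  have h1 : c₁ * L * ρ' ≤ c₁ * L * (κ₀ / ((c₁ + 1) * L)) :=
    mul_le_mul_of_nonneg_left (hρ'1.trans (min_le_right _ _)) (by positivity)
  have h2 : c₁ * L * (κ₀ / ((c₁ + 1) * L)) = c₁ / (c₁ + 1) * κ₀ := by
    field_simp
  have h3 : c₁ / (c₁ + 1) * κ₀ ≤ κ₀ := by
    have : c₁ / (c₁ + 1) ≤ 1 := by
      rw [div_le_one (by positivity)]
      linarith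
    nlinarith
  linarith [h1, h2, h3]

/-! ## 4. The A-only versions (R17's literal frame) — the OPEN strengthening, and monotonicity -/

/-- P₀ in the energy gauge alone (R16/R17's frame).  OPEN: the η-Moser engine needs the enstrophy
as a start norm, which `A ≤ M` does not bound universally; no counterexample is known either
(memo §4, T-18.3). -/
@[conjecture] def SwirlFreePolynomialBoundA : Prop :=
  ∃ K : ℝ, 0 < K ∧
    ∀ (u : ℝ → EuclideanSpace ℝ (Fin 3) → EuclideanSpace ℝ (Fin 3))
      (p : ℝ → EuclideanSpace ℝ (Fin 3) → ℝ),
      IsSuitableWeakSolutionInBall 1 0 u p →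
      (∀ t ∈ Ioo (-1 : ℝ) 0, IsAxisymmetric (u t)) →
      (∀ t ∈ Ioo (-1 : ℝ) 0, IsAxisymmetricScalar (p t)) →
      ∀ M : ℝ, 0 ≤ M → EnergyGauge M u →
      ∀ z₀ ∈ parabolicCylinder (1 / 8) (0 : ℝ × EuclideanSpace ℝ (Fin 3)), cylRadius z₀.2 = 0 →
      (∀ᵐ z ∂(volume.restrict (parabolicCylinder (1 / 4) z₀)), swirl (u z.1) z.2 = 0) →
      ∀ᵐ z ∂(volume.restrict (parabolicCylinder (1 / 64) z₀)), ‖u z.1 z.2‖ ≤ K * (1 + M) ^ K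

/-- N₀ in the energy gauge alone: for `Pe = meridionalPeclet`, `κ₀ = κ 0` this is LITERALLY
ROUND-17's `MeridionalSwirlLaw κ` at `a = b` (= LADDER seed s17-1). -/
def SwirlFreeBudgetA
    (Pe : ℝ → ℝ × EuclideanSpace ℝ (Fin 3) →
      (ℝ → EuclideanSpace ℝ (Fin 3) → EuclideanSpace ℝ (Fin 3)) → ℝ≥0∞) (κ₀ : ℝ) : Prop :=
  ∃ K : ℝ, 0 < K ∧
    ∀ (u : ℝ → EuclideanSpace ℝ (Fin 3) → EuclideanSpace ℝ (Fin 3))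
      (p : ℝ → EuclideanSpace ℝ (Fin 3) → ℝ),
      IsSuitableWeakSolutionInBall 1 0 u p →
      (∀ t ∈ Ioo (-1 : ℝ) 0, IsAxisymmetric (u t)) →
      (∀ t ∈ Ioo (-1 : ℝ) 0, IsAxisymmetricScalar (p t)) →
      ∀ M : ℝ, 0 ≤ M → EnergyGauge M u →
      ∀ z₀ ∈ parabolicCylinder (1 / 8) (0 : ℝ × EuclideanSpace ℝ (Fin 3)), cylRadius z₀.2 = 0 →
      (∀ᵐ z ∂(volume.restrict (parabolicCylinder (1 / 4) z₀)), swirl (u z.1) z.2 = 0) →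
      ∃ ρ₁ : ℝ, (K * (1 + M) ^ K)⁻¹ ≤ ρ₁ ∧ ρ₁ ≤ 1 / 4 ∧
        ∀ ρ' : ℝ, 0 < ρ' → ρ' ≤ ρ₁ → Pe ρ' z₀ u ≤ ENNReal.ofReal κ₀

/-- The A-only P₀ implies the full-gauge P₀ (more hypotheses, same conclusion). -/
theorem swirlFreePolynomialBound_of_A (h : SwirlFreePolynomialBoundA) : SwirlFreePolynomialBound := by
  obtain ⟨K, hK, hb⟩ := h
  exact ⟨K, hK, fun u p hsol hax hpax M hM hG z₀ hz₀ haxis hsw =>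
    hb u p hsol hax hpax M hM hG.energyGauge z₀ hz₀ haxis hsw⟩

/-- The A-only budget implies the full-gauge budget. -/
theorem swirlFreeBudget_of_A
    {Pe : ℝ → ℝ × EuclideanSpace ℝ (Fin 3) →
      (ℝ → EuclideanSpace ℝ (Fin 3) → EuclideanSpace ℝ (Fin 3)) → ℝ≥0∞} {κ₀ : ℝ}
    (h : SwirlFreeBudgetA Pe κ₀) : SwirlFreeBudget Pe κ₀ := by
  obtain ⟨K, hK, hb⟩ := h
  exact ⟨K, hK, fun u p hsol hax hpax M hM hG z₀ hz₀ haxis hsw =>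
    hb u p hsol hax hpax M hM hG.energyGauge z₀ hz₀ haxis hsw⟩

/-- The A-only join (same proof): IF the A-only P₀ holds, the A-only budget follows for every
velocity-dominated gauge — so the open question of §4 is exactly `SwirlFreePolynomialBoundA`. -/
theorem swirlFreeBudgetA_of_polynomialBoundA {c₁ : ℝ}
    {Pe : ℝ → ℝ × EuclideanSpace ℝ (Fin 3) →
      (ℝ → EuclideanSpace ℝ (Fin 3) → EuclideanSpace ℝ (Fin 3)) → ℝ≥0∞}
    (hc₁ : 0 ≤ c₁) (hPe : VelocityDominated c₁ Pe) (hP : SwirlFreePolynomialBoundA) {κ₀ : ℝ}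
    (hκ₀ : 0 < κ₀) : SwirlFreeBudgetA Pe κ₀ := by
  obtain ⟨K, hK, hb⟩ := hP
  refine ⟨max (max K 64) ((c₁ + 1) * K / κ₀),
    lt_of_lt_of_le (by norm_num) (le_max_of_le_left (le_max_right _ _)), ?_⟩
  intro u p hsol hax hpax M hM hG z₀ hz₀ haxis hsw
  have hbound := hb u p hsol hax hpax M hM hG z₀ hz₀ haxis hsw
  set L := K * (1 + M) ^ K with hL_def
  have hL : 0 < L := by positivity
  refine ⟨min (1 / 64) (κ₀ / ((c₁ + 1) * L)), threshold_lower_bound hK hc₁ hκ₀ hM,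
    le_trans (min_le_left _ _) (by norm_num), ?_⟩
  intro ρ' hρ' hρ'1
  have hsub : parabolicCylinder ρ' z₀ ⊆ parabolicCylinder (1 / 64) z₀ :=
    parabolicCylinder_subset_of_le hρ'.le (hρ'1.trans (min_le_left _ _)) z₀
  have hae : ∀ᵐ q ∂(volume.restrict (parabolicCylinder ρ' z₀)), ‖u q.1 q.2‖ ≤ L :=
    ae_restrict_of_ae_restrict_of_subset hsub hbound
  refine (hPe ρ' z₀ u L hρ' hL.le hae).trans (ENNReal.ofReal_le_ofReal ?_)
  have h1 : c₁ * L * ρ' ≤ c₁ * L * (κ₀ / ((c₁ + 1) * L)) :=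
    mul_le_mul_of_nonneg_left (hρ'1.trans (min_le_right _ _)) (by positivity)
  have h2 : c₁ * L * (κ₀ / ((c₁ + 1) * L)) = c₁ / (c₁ + 1) * κ₀ := by
    field_simp
  have h3 : c₁ / (c₁ + 1) * κ₀ ≤ κ₀ := by
    have : c₁ / (c₁ + 1) ≤ 1 := by
      rw [div_le_one (by positivity)]
      linarith
    nlinarith
  linarith [h1, h2, h3]

end

end Summit.NavierStokesRegularity.NavierStokesRegularity.Theorems.SwirlFreeBudget
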